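import Summits.QuantumFields.BalabanUV.Beta.SymTablesOf
import Summits.QuantumFields.BalabanUV.Beta.MixedJetTablesPlug

/-!
# `BalabanUV.Beta.CombTablesAn1` — row D1 ∕ (C1), RULING R-D1-g55-1 (2): **THE COMB SCHEME's TABLE RECORD AS ONE `SymTables` TERM** — F6b's packer
# `tabsOf` at an1's ROOTED single-axis-order (`σ = 1`) tables `vhSAt ρ_c`, `hessFFAt ρ_c`, `vh₂SAn1`, `mixFFAt ρ_c` with their eight letters

WHY (located).  Road «BF-x»'s (J1) fork was ruled RE-TABLE (R-D1-g54-1 (1)(b), FINAL as to direction in R-D1-g55-1): the road keeps its comb slice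
`G₀ = coDressKBmAt ρ_c n (KInvStep n 0)` and carries the COMB scheme's own table record — first AND second order — in place of the (0.4) literal's
`symTablesAn1S2`.  an1 custody's located answer to condition (A) (journal l.60425, [AN1-G95-W1]): the comb scheme's single-order tables ARE typed by name
(an1-lineage Literature `AveragingHessianKernelsRooted.vhSAt ∕ hessFFAt`, `AveragingMixedJetTables.vh₂SAt ∕ mixFFAt`, over node 5ρ's ONE rooted comb
`loopCAt` = the pair `(σ,σ′) = (1,1)` of the (0.4) family) and their letters are in the tree; the axis-symmetrised tables are DIFFERENT decls.  This file
packs the comb tables at the centred root `ρ_c = ctr 4 Lc` as ONE record, so that a re-tabled pin at blocking `Lc^m` reads `combTablesAn1S2 (Lc^m) …`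
by name, exactly as the literal reads `symTablesAn1S2 3 (Lc^m) (cΛ m)`.

WHAT ([folklore] packaging BY NAME; ONE [our object — bookkeeping] def, a `tabsOf` call; `d = 3` because the row border table `vh₂SAn1` is typed at `d = 3`):
* §1 the comb tables' letters at the centred root in `SymTables`' shapes (any `d` for the first-order and mixed tables): (LV) `vhSAt_hV_ctr`
  (`locStencil_vhSAt`), (LH) `hessFFAt_hH_ctr` (`biLoc_hessFFAt`), (TV) `vhSAt_hVt_ctr`, (TH) `hessFFAt_hHt_ctr`, (Lmix) `mixFFAt_hmix_ctr` ∕ (Tmix)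
  `mixFFAt_hmixt_ctr` (an2's `MixedJetTablesPlug.hmix_an1 ∕ hmixt_an1` at `ctrOff`); (LB)(TB) are the row's `SecondOrderTableLawEnd.locStencil₂_vh₂SAn1 ∕
  vh₂SAn1_translate` (`Odd Lc`).
* §2 **`combTablesAn1S2 Lc hLc cΛ : SymTables 3 Lc := tabsOf Lc (vhSAt ρ_c 3 Lc) (hessFFAt ρ_c Lc) (fun j => cΛ·wM1 3 Lc j) (vh₂SAn1 Lc) (mixFFAt ρ_c Lc) ⟨letters⟩`**;
  field lemmas `_V ∕ _H ∕ _vh₂S ∕ _mixFF` (`rfl`), `_M_apply`, `_M` (`= M1Of 3 Lc (hessFFAt ρ_c Lc) cΛ`, `rfl`).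
WHAT THIS IS NOT: not a statement that the road's re-tabled (J1) row is bounded (condition (B) of R-D1-g54-1 — a by-value measurement — decides viability;
nothing is priced here); not a value of any table (an1's engines tabulate them OUTSIDE Lean — `HOME/b2b-balaban-beta-an1-g32/tables/TABLES.md` §2, provenance
only); not a change to the RECORD (ROOT M‴ reads `symTablesAn1S2`; unchanged).  0 sorry, 0 `def … : Prop`, nothing cited; 0∕4 row-D1 binders; NOT (C1) complete,
NOT D1, NEVER «G-an2-4 closed», NOT BetaPertH, NOT continuum, NOT Clay.

HONEST DEPENDENCY (page 1, mandatory): continuum YM on T⁴ ⇐ BetaPertH ∧ nine spine estimates (0/9 proved); BetaPertH ⇐ (D1) ∧ (D4) ∧ CAP+tail;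
G-an2-4 gates asym, D1 and NE2/3/4.  Row D1 ∕ (C1) OWNER an2, gen 55, 2026-08-24.  No existing file touched.
-/

noncomputable section

namespace Summit.QuantumFields.BalabanUV.Beta.CombTablesAn1

open Literature.MathematicalPhysics.QuantumFieldTheory.Balaban1983to89
open Literature.MathematicalPhysics.QuantumFieldTheory.Balaban1983to89.Beta
open ExpKernelCalculus (MKer BiLoc VertexFamily shiftK)
open OneStepResolventKernel (Fib LocStencil)
open AffineAveraging (Site box toSite)
open AveragingContoursRooted (ctr ctrOff ctrOff_mem_box)
open AveragingHessianKernelsRooted (vhSAt hessFFAt locStencil_vhSAt biLoc_hessFFAt vhSAt_translate hessFFAt_translate)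
open AveragingMixedJetTables (mixFFAt)
open BalabanCompositeJets (LocStencil₂)
open SecondOrderResponse (LocStencilFM)
open BalabanStepW2 (wM1)
open Summit.QuantumFields.BalabanUV.Beta.SpineRooted (M1Of)
open Summit.QuantumFields.BalabanUV.Beta.SymmetrisedStepJets (SymTables)
open Summit.QuantumFields.BalabanUV.Beta.SymTablesOf (tabsOf tabsOf_M_eq_M1Of)
open Summit.QuantumFields.BalabanUV.Beta.SecondOrderSocketIdentification (vh₂SAn1)
open Summit.QuantumFields.BalabanUV.Beta.SecondOrderTableLawEnd (locStencil₂_vh₂SAn1 vh₂SAn1_translate)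
open Summit.QuantumFields.BalabanUV.Beta.MixedJetTablesPlug (hmix_an1 hmixt_an1)

variable {d : ℕ}

/-! ## §1 The comb tables' letters at the centred root, in `SymTables`' shapes -/

section Letters

/-- [folklore] **(LV) at the centred root**: an1's rooted comb border table is a local stencil family at every rate (`locStencil_vhSAt` at `ctrOff`). -/
theorem vhSAt_hV_ctr {L : ℕ} (hL : 1 ≤ L) : ∀ δ : ℝ, 0 ≤ δ → ∃ C : ℝ, LocStencil (vhSAt (ctr (d + 1) L) d L) C δ :=
  fun _ hδ => ⟨_, locStencil_vhSAt hL (ctrOff_mem_box hL) hδ⟩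

/-- [folklore] **(LH) at the centred root**: an1's rooted comb constraint Hessian is a first-order vertex family at every rate (`biLoc_hessFFAt` at `ctrOff`). -/
theorem hessFFAt_hH_ctr {L : ℕ} (hL : 1 ≤ L) : ∀ δ : ℝ, 0 ≤ δ → ∃ C : ℝ, VertexFamily (hessFFAt (ctr (d + 1) L) L) L C δ :=
  fun _ hδ => ⟨_, fun μ y => biLoc_hessFFAt hL μ y (ctrOff_mem_box hL) hδ⟩

/-- [folklore] **(TV) at the centred root** (`vhSAt_translate`). -/
theorem vhSAt_hVt_ctr {L : ℕ} (hL : 1 ≤ L) :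
    ∀ (κ : Fin (d + 1)) (u t : Fin (d + 1) → ℤ), vhSAt (ctr (d + 1) L) d L rfl κ (u + (L : ℤ) • t) = shiftK (-((L : ℤ) • t)) (vhSAt (ctr (d + 1) L) d L rfl κ u) :=
  fun κ u t => vhSAt_translate _ hL κ u t

/-- [folklore] **(TH) at the centred root** (`hessFFAt_translate`). -/
theorem hessFFAt_hHt_ctr (L : ℕ) :
    ∀ (μ : Fin (d + 1)) (y t : Fin (d + 1) → ℤ), hessFFAt (ctr (d + 1) L) L μ (y + t) = shiftK (-((L : ℤ) • t)) (hessFFAt (ctr (d + 1) L) L μ y) :=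
  fun μ y t => hessFFAt_translate _ μ y t

/-- [folklore] **(Lmix) at the centred root**: an1's rooted comb mixed table is a localised field–multiplier family (an2's `hmix_an1` at `ctrOff`). -/
theorem mixFFAt_hmix_ctr {L : ℕ} (hL : 1 ≤ L) : ∃ C δ : ℝ, 0 < δ ∧ LocStencilFM L (mixFFAt (ctr (d + 1) L) L) C δ :=
  hmix_an1 hL (ctrOff_mem_box hL)

/-- [folklore] **(Tmix) at the centred root** (an2's `hmixt_an1`). -/
theorem mixFFAt_hmixt_ctr (L : ℕ) :
    ∀ (κ : Fin (d + 1)) (u : Fin (d + 1) → ℤ) (μ : Fin (d + 1)) (w t : Fin (d + 1) → ℤ),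
      mixFFAt (ctr (d + 1) L) L κ (u + (L : ℤ) • t) μ (w + t) = shiftK (-((L : ℤ) • t)) (mixFFAt (ctr (d + 1) L) L κ u μ w) :=
  hmixt_an1 (Lc := L) (ctr (d + 1) L)

end Letters

/-! ## §2 The comb scheme's table record -/

section Record

variable (Lc : ℕ)

/-- [our object — bookkeeping] **THE COMB SCHEME's TABLE RECORD OF ROW D1 AS A CLOSED TERM** (centred root `ρ_c = ctr 4 Lc`; the comb twin of
`SymSecondOrderTablesAn1.symTablesAn1S2 3 Lc cΛ`): F6b's `tabsOf` at an1's rooted single-axis-order tables — border `vhSAt ρ_c 3 Lc`, constraint Hessian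
`hessFFAt ρ_c Lc` (multipliers `cΛ·wM1 j • hessFFAt`, the `M1Of` shape), row border `vh₂SAn1 Lc` (the anti-twin packed `(g,h)`-symmetrisation of `vh₂SAt ρ_c Lc`),
mixed `mixFFAt ρ_c Lc` — with their eight letters.  `hLc : Odd Lc` is the row's standing parity hypothesis (needed by (LB)).  A CANDIDATE record; asserts nothing. -/
def combTablesAn1S2 (hLc : Odd Lc) (cΛ : ℝ) : SymTables 3 Lc :=
  tabsOf Lc (vhSAt (ctr 4 Lc) 3 Lc) (hessFFAt (ctr 4 Lc) Lc) (fun j => cΛ * wM1 3 Lc j) (vh₂SAn1 Lc) (mixFFAt (ctr 4 Lc) Lc)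
    (vhSAt_hV_ctr hLc.pos) (hessFFAt_hH_ctr hLc.pos) (locStencil₂_vh₂SAn1 hLc) (mixFFAt_hmix_ctr hLc.pos)
    (vhSAt_hVt_ctr hLc.pos) (hessFFAt_hHt_ctr Lc) (vh₂SAn1_translate hLc.pos) (mixFFAt_hmixt_ctr Lc)

variable {Lc} (hLc : Odd Lc) (cΛ : ℝ)

/-- [folklore] the record's border table (`rfl`). -/
@[simp] theorem combTablesAn1S2_V : (combTablesAn1S2 Lc hLc cΛ).V = vhSAt (ctr 4 Lc) 3 Lc := rfl

/-- [folklore] the record's constraint Hessian table (`rfl`). -/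
@[simp] theorem combTablesAn1S2_H : (combTablesAn1S2 Lc hLc cΛ).H = hessFFAt (ctr 4 Lc) Lc := rfl

/-- [folklore] the record's row border table (`rfl`). -/
@[simp] theorem combTablesAn1S2_vh₂S : (combTablesAn1S2 Lc hLc cΛ).vh₂S = vh₂SAn1 Lc := rfl

/-- [folklore] the record's mixed table (`rfl`). -/
@[simp] theorem combTablesAn1S2_mixFF : (combTablesAn1S2 Lc hLc cΛ).mixFF = mixFFAt (ctr 4 Lc) Lc := rfl

/-- [folklore] the record's multiplier tables entrywise (`rfl`). -/
theorem combTablesAn1S2_M_apply (j : ℕ) (μ : Fin 4) (w : Site 4) :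
    (combTablesAn1S2 Lc hLc cΛ).M j μ w = (cΛ * wM1 3 Lc j) • hessFFAt (ctr 4 Lc) Lc μ w := rfl

/-- [folklore] the record's multiplier tables ARE `M1Of 3 Lc (hessFFAt ρ_c Lc) cΛ` (`tabsOf_M_eq_M1Of`, `rfl`). -/
theorem combTablesAn1S2_M [NeZero Lc] : (combTablesAn1S2 Lc hLc cΛ).M = M1Of 3 Lc (hessFFAt (ctr 4 Lc) Lc) cΛ := rfl

end Record

end Summit.QuantumFields.BalabanUV.Beta.CombTablesAn1

end
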